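import Literature.RepresentationTheory.Kovacevic2021.SU21CohomologicalClassification
import HarnessLib

/-!
# The `(𝔤,K)`-cohomology table of an arbitrary irreducible `K`-type datum for `SU(2,1)`
# (Borel–Wallach VI Thm 4.11 (1)–(3), datum form)

Continuation of `Literature.RepresentationTheory.Kovacevic2021.SU21CohomologicalClassification` (an
irreducible datum `𝒟` with `dim H^q(𝔤𝔩₃, 𝔨; V) ≠ 0` for some `q` has the `K`-types of one of the six
modules `U(0)`, `U(0,±6)`, `Z(±3)`, `W(3,0)`) and `SU21CohomologyAllDegrees` (the cohomology of those six
modules in all degrees; the cochain dimensions `dim C^q(𝔤𝔩₃, 𝔨; V)` of ANY datum in terms of which of the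
`K`-types `V_{1,0}, V_{2,±3}, V_{1,±6}, V_{3,0}` of `Λ^q 𝔭` occur in `V`).

**What is proved.**  For every datum the relative cochain spaces are determined by the `K`-types; for
the six `K`-type sets above they are concentrated in ONE parity of the degree (`U(0)`: degrees `0,2,4`;
`U(0,±6)`, `W(3,0)`: degree `2`; `Z(±3)`: degrees `1,3`), so every differential of the relative complex
vanishes and `dim H^q = dim C^q` (§1, §2).  Hence (§3, `table_of_isIrreducible`,
`exists_model_cohomology_of_isIrreducible`): an irreducible datum `𝒟` with some `H^q(𝔤𝔩₃,𝔨;V) ≠ 0` has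
the `K`-types of one of the six modules `T` AND `dim H^q(𝔤𝔩₃, 𝔨; 𝒟.V) = dim H^q(𝔤𝔩₃, 𝔨; T.V)` for all
`q` — the full statement of [BorelWallach2000, VI Thm 4.11] for `SU(2,1)` (`n = 2`) at the level of
`K`-type data: (1) `V ∈ Π^ρ(G)`; (2) `H^q(𝔤,K;D_i) = ℂ` for `q = 2`, `0` otherwise; (3)
`H^q(𝔤,K;J_{ij}) = ℂ` for `q = i + j + 2l`, `0 ≤ l ≤ 2 - i - j`, `0` otherwise; and conversely every datum
with one of these six `K`-type sets has that (non-zero) cohomology, so for irreducible data "some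
`H^q ≠ 0`" is EQUIVALENT to "`S` is one of the six" (`exists_finrank_relCohomology_ne_zero_iff_of_isIrreducible`,
the datum form of `Π^ρ(SU(2,1)) = {J_{00}, J_{10}, J_{01}, D₀, D₁, D₂}`).  Corollaries:
`dim H^q ≤ 1` for every irreducible datum and every `q` (`finrank_relCohomology_le_one_of_isIrreducible`),
and `H¹ ≠ 0` exactly for the `K`-types of the two ladder representations `Z(±3) = J_{1,0}, J_{0,1}`
(`finrank_relCohomology_one_ne_zero_iff_of_isIrreducible`).

## References

* A. Borel, N. Wallach (2000), I §1.2, II Prop. 3.1, VI 4.8 p. 131, Thm 4.11 p. 132 (held chunks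
  p0165–p0169 of `book:borel2000-…`). [BorelWallach2000]
* D. Kovačević, *Unitary `(𝔤,K)` modules of `SU(2,1)`*, Acta Math. Spalatensia 1 (2021) 105–125
  (arXiv:1810.01752), §4 Thm 5. [Kovacevic2021]
-/

noncomputable section

open Module
open Literature.Algebra.Lie Literature.Algebra.Lie.ChevalleyEilenberg

namespace Literature.RepresentationTheory.Kovacevic2021

-- Mathlib idiom (Mathlib/Algebra/Lie/OfAssociative.lean): commutator brackets on associative algebras; needed for
-- the `𝔤𝔩(3,ℂ)`-module structure on `𝒟.V`, as in every file of this directory.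
attribute [local instance 100] LieRing.ofAssociativeRing

namespace SU21Datum

variable (𝒟 : SU21Datum)

/-! ## §1 Cohomology equals cochains when the cochains live in one parity (any datum) -/

/-- `dim H⁰(𝔤, 𝔨; V) = dim C⁰(𝔤, 𝔨; V)` as soon as `C¹(𝔤, 𝔨; V) = 0` (every `0`-cochain is then closed).
[cite: BorelWallach2000, I §1.2 (3)] -/
theorem finrank_relCohomology_zero_eq (h1 : 𝒟.relCochain 1 = ⊥) :
    finrank ℂ (relCohomology ℂ gl3 𝒟.V kSub 0) = finrank ℂ (𝒟.relCochain 0) :=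
  finrank_cohomology_zero_of_closed (Subcomplex.rel ℂ gl3 𝒟.V kSub) fun f hf => by
    have hd : d ℂ gl3 𝒟.V 0 f ∈ 𝒟.relCochain 1 := (Subcomplex.rel ℂ gl3 𝒟.V kSub).d_mem 0 f hf
    rw [h1, Submodule.mem_bot] at hd
    exact hd

/-- **Even parity.** If `C¹(𝔤, 𝔨; V) = C³(𝔤, 𝔨; V) = 0` then `dim H^q(𝔤, 𝔨; V) = dim C^q(𝔤, 𝔨; V)` for every
`q` (all differentials vanish; `C^q = 0` for `q ≥ 5`). [cite: BorelWallach2000, II Prop. 3.1 (b), VI Thm 4.11] -/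
theorem finrank_relCohomology_eq_finrank_relCochain_of_odd (h1 : 𝒟.relCochain 1 = ⊥)
    (h3 : 𝒟.relCochain 3 = ⊥) (q : ℕ) :
    finrank ℂ (relCohomology ℂ gl3 𝒟.V kSub q) = finrank ℂ (𝒟.relCochain q) := by
  rcases Nat.lt_or_ge q 5 with hq | hq
  · interval_cases q
    · exact 𝒟.finrank_relCohomology_zero_eq h1
    · rw [𝒟.finrank_relCohomology_eq_zero 1 h1, h1, finrank_bot]
    · exact 𝒟.finrank_relCohomology_succ_eq 1 h1 h3
    · rw [𝒟.finrank_relCohomology_eq_zero 3 h3, h3, finrank_bot]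
    · exact 𝒟.finrank_relCohomology_succ_eq 3 h3 (𝒟.relCochain_eq_bot_of_five_le le_rfl)
  · rw [𝒟.finrank_relCohomology_eq_zero_of_five_le hq, 𝒟.relCochain_eq_bot_of_five_le hq, finrank_bot]

/-- **Odd parity.** If `C⁰ = C² = C⁴ = 0` then `dim H^q(𝔤, 𝔨; V) = dim C^q(𝔤, 𝔨; V)` for every `q`.
[cite: BorelWallach2000, II Prop. 3.1 (b), VI Thm 4.11] -/
theorem finrank_relCohomology_eq_finrank_relCochain_of_even (h0 : 𝒟.relCochain 0 = ⊥)
    (h2 : 𝒟.relCochain 2 = ⊥) (h4 : 𝒟.relCochain 4 = ⊥) (q : ℕ) :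
    finrank ℂ (relCohomology ℂ gl3 𝒟.V kSub q) = finrank ℂ (𝒟.relCochain q) := by
  rcases Nat.lt_or_ge q 5 with hq | hq
  · interval_cases q
    · rw [𝒟.finrank_relCohomology_zero_eq_zero h0, h0, finrank_bot]
    · exact 𝒟.finrank_relCohomology_succ_eq 0 h0 h2
    · rw [𝒟.finrank_relCohomology_eq_zero 2 h2, h2, finrank_bot]
    · exact 𝒟.finrank_relCohomology_succ_eq 2 h2 h4
    · rw [𝒟.finrank_relCohomology_eq_zero 4 h4, h4, finrank_bot]
  · rw [𝒟.finrank_relCohomology_eq_zero_of_five_le hq, 𝒟.relCochain_eq_bot_of_five_le hq, finrank_bot]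

/-! ## §2 The table of a datum with the `K`-types of one of the six modules (any such datum) -/

/-- A datum with the `K`-types of `U(0) = J_{0,0}` (`S = {V_{1,0}}`) has `dim H^q = 1` for `q = 0, 2, 4` and
`0` otherwise. [cite: BorelWallach2000, VI Thm 4.11 (3) (`J_{0,0}`)] -/
theorem finrank_relCohomology_of_S_eq_trivialMod (hS : 𝒟.S = trivialMod.S) (q : ℕ) :
    finrank ℂ (relCohomology ℂ gl3 𝒟.V kSub q) = if q = 0 ∨ q = 2 ∨ q = 4 then 1 else 0 := by
  have h10 : ((1 : ℤ), (0 : ℤ)) ∈ 𝒟.S := by rw [hS]; exact six_Ktypes.1.1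
  have h23 : ((2 : ℤ), (3 : ℤ)) ∉ 𝒟.S := by rw [hS]; exact six_Ktypes.1.2.1
  have h2m3 : ((2 : ℤ), (-3 : ℤ)) ∉ 𝒟.S := by rw [hS]; exact six_Ktypes.1.2.2
  have h16 : ((1 : ℤ), (6 : ℤ)) ∉ 𝒟.S := by rw [hS]; exact six_Ktypes₂.1.1
  have h30 : ((3 : ℤ), (0 : ℤ)) ∉ 𝒟.S := by rw [hS]; exact six_Ktypes₂.1.2.1
  have h1m6 : ((1 : ℤ), (-6 : ℤ)) ∉ 𝒟.S := by rw [hS]; exact six_Ktypes₂.1.2.2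
  have h1 : 𝒟.relCochain 1 = ⊥ := 𝒟.relCochain_one_eq_bot h23 h2m3
  have h3 : 𝒟.relCochain 3 = ⊥ := 𝒟.relCochain_three_eq_bot h23 h2m3
  rw [𝒟.finrank_relCohomology_eq_finrank_relCochain_of_odd h1 h3]
  rcases Nat.lt_or_ge q 5 with hq | hq
  · interval_cases q
    · rw [finrank_relCochain_zero, if_pos h10, if_pos (Or.inl rfl)]
    · rw [h1, finrank_bot, if_neg (by omega)]
    · rw [finrank_relCochain_two, if_neg h16, if_neg h30, if_pos h10, if_neg h1m6, if_pos (Or.inr (Or.inl rfl))]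
    · rw [h3, finrank_bot, if_neg (by omega)]
    · rw [finrank_relCochain_four, if_pos h10, if_pos (Or.inr (Or.inr rfl))]
  · rw [𝒟.relCochain_eq_bot_of_five_le hq, finrank_bot, if_neg (by omega)]

/-- A datum with the `K`-types of `D₂ = U(0,6)` has `dim H^q = [q = 2]`. [cite: BorelWallach2000, VI Thm 4.11 (2)] -/
theorem finrank_relCohomology_of_S_eq_holDS (hS : 𝒟.S = holDS.S) (q : ℕ) :
    finrank ℂ (relCohomology ℂ gl3 𝒟.V kSub q) = if q = 2 then 1 else 0 := by
  have h10 : ((1 : ℤ), (0 : ℤ)) ∉ 𝒟.S := by rw [hS]; exact six_Ktypes.2.1.1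
  have h23 : ((2 : ℤ), (3 : ℤ)) ∉ 𝒟.S := by rw [hS]; exact six_Ktypes.2.1.2.1
  have h2m3 : ((2 : ℤ), (-3 : ℤ)) ∉ 𝒟.S := by rw [hS]; exact six_Ktypes.2.1.2.2
  have h16 : ((1 : ℤ), (6 : ℤ)) ∈ 𝒟.S := by rw [hS]; exact six_Ktypes₂.2.1.1
  have h30 : ((3 : ℤ), (0 : ℤ)) ∉ 𝒟.S := by rw [hS]; exact six_Ktypes₂.2.1.2.1
  have h1m6 : ((1 : ℤ), (-6 : ℤ)) ∉ 𝒟.S := by rw [hS]; exact six_Ktypes₂.2.1.2.2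
  have h1 : 𝒟.relCochain 1 = ⊥ := 𝒟.relCochain_one_eq_bot h23 h2m3
  have h3 : 𝒟.relCochain 3 = ⊥ := 𝒟.relCochain_three_eq_bot h23 h2m3
  rw [𝒟.finrank_relCohomology_eq_finrank_relCochain_of_odd h1 h3]
  rcases Nat.lt_or_ge q 5 with hq | hq
  · interval_cases q
    · rw [𝒟.relCochain_zero_eq_bot h10, finrank_bot, if_neg (by omega)]
    · rw [h1, finrank_bot, if_neg (by omega)]
    · rw [finrank_relCochain_two, if_pos h16, if_neg h30, if_neg h10, if_neg h1m6, if_pos rfl]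
    · rw [h3, finrank_bot, if_neg (by omega)]
    · rw [𝒟.relCochain_four_eq_bot h10, finrank_bot, if_neg (by omega)]
  · rw [𝒟.relCochain_eq_bot_of_five_le hq, finrank_bot, if_neg (by omega)]

/-- A datum with the `K`-types of `D₀ = U(0,-6)` has `dim H^q = [q = 2]`. [cite: BorelWallach2000, VI Thm 4.11 (2)] -/
theorem finrank_relCohomology_of_S_eq_antiholDS (hS : 𝒟.S = antiholDS.S) (q : ℕ) :
    finrank ℂ (relCohomology ℂ gl3 𝒟.V kSub q) = if q = 2 then 1 else 0 := by
  have h10 : ((1 : ℤ), (0 : ℤ)) ∉ 𝒟.S := by rw [hS]; exact six_Ktypes.2.2.1.1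
  have h23 : ((2 : ℤ), (3 : ℤ)) ∉ 𝒟.S := by rw [hS]; exact six_Ktypes.2.2.1.2.1
  have h2m3 : ((2 : ℤ), (-3 : ℤ)) ∉ 𝒟.S := by rw [hS]; exact six_Ktypes.2.2.1.2.2
  have h16 : ((1 : ℤ), (6 : ℤ)) ∉ 𝒟.S := by rw [hS]; exact six_Ktypes₂.2.2.1.1
  have h30 : ((3 : ℤ), (0 : ℤ)) ∉ 𝒟.S := by rw [hS]; exact six_Ktypes₂.2.2.1.2.1
  have h1m6 : ((1 : ℤ), (-6 : ℤ)) ∈ 𝒟.S := by rw [hS]; exact six_Ktypes₂.2.2.1.2.2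
  have h1 : 𝒟.relCochain 1 = ⊥ := 𝒟.relCochain_one_eq_bot h23 h2m3
  have h3 : 𝒟.relCochain 3 = ⊥ := 𝒟.relCochain_three_eq_bot h23 h2m3
  rw [𝒟.finrank_relCohomology_eq_finrank_relCochain_of_odd h1 h3]
  rcases Nat.lt_or_ge q 5 with hq | hq
  · interval_cases q
    · rw [𝒟.relCochain_zero_eq_bot h10, finrank_bot, if_neg (by omega)]
    · rw [h1, finrank_bot, if_neg (by omega)]
    · rw [finrank_relCochain_two, if_neg h16, if_neg h30, if_neg h10, if_pos h1m6, if_pos rfl]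
    · rw [h3, finrank_bot, if_neg (by omega)]
    · rw [𝒟.relCochain_four_eq_bot h10, finrank_bot, if_neg (by omega)]
  · rw [𝒟.relCochain_eq_bot_of_five_le hq, finrank_bot, if_neg (by omega)]

/-- A datum with the `K`-types of `D₁ = W(3,0)` has `dim H^q = [q = 2]`. [cite: BorelWallach2000, VI Thm 4.11 (2)] -/
theorem finrank_relCohomology_of_S_eq_midDS (hS : 𝒟.S = midDS.S) (q : ℕ) :
    finrank ℂ (relCohomology ℂ gl3 𝒟.V kSub q) = if q = 2 then 1 else 0 := by
  have h10 : ((1 : ℤ), (0 : ℤ)) ∉ 𝒟.S := by rw [hS]; exact six_Ktypes.2.2.2.1.1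
  have h23 : ((2 : ℤ), (3 : ℤ)) ∉ 𝒟.S := by rw [hS]; exact six_Ktypes.2.2.2.1.2.1
  have h2m3 : ((2 : ℤ), (-3 : ℤ)) ∉ 𝒟.S := by rw [hS]; exact six_Ktypes.2.2.2.1.2.2
  have h16 : ((1 : ℤ), (6 : ℤ)) ∉ 𝒟.S := by rw [hS]; exact six_Ktypes₂.2.2.2.1.1
  have h30 : ((3 : ℤ), (0 : ℤ)) ∈ 𝒟.S := by rw [hS]; exact six_Ktypes₂.2.2.2.1.2.1
  have h1m6 : ((1 : ℤ), (-6 : ℤ)) ∉ 𝒟.S := by rw [hS]; exact six_Ktypes₂.2.2.2.1.2.2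
  have h1 : 𝒟.relCochain 1 = ⊥ := 𝒟.relCochain_one_eq_bot h23 h2m3
  have h3 : 𝒟.relCochain 3 = ⊥ := 𝒟.relCochain_three_eq_bot h23 h2m3
  rw [𝒟.finrank_relCohomology_eq_finrank_relCochain_of_odd h1 h3]
  rcases Nat.lt_or_ge q 5 with hq | hq
  · interval_cases q
    · rw [𝒟.relCochain_zero_eq_bot h10, finrank_bot, if_neg (by omega)]
    · rw [h1, finrank_bot, if_neg (by omega)]
    · rw [finrank_relCochain_two, if_neg h16, if_pos h30, if_neg h10, if_neg h1m6, if_pos rfl]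
    · rw [h3, finrank_bot, if_neg (by omega)]
    · rw [𝒟.relCochain_four_eq_bot h10, finrank_bot, if_neg (by omega)]
  · rw [𝒟.relCochain_eq_bot_of_five_le hq, finrank_bot, if_neg (by omega)]

/-- A datum with the `K`-types of `J_{1,0} = Z(3)` has `dim H^q = [q ∈ {1,3}]`. [cite: BorelWallach2000, VI Thm 4.11 (3)] -/
theorem finrank_relCohomology_of_S_eq_ladderPlus (hS : 𝒟.S = ladderPlus.S) (q : ℕ) :
    finrank ℂ (relCohomology ℂ gl3 𝒟.V kSub q) = if q = 1 ∨ q = 3 then 1 else 0 := by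
  have h10 : ((1 : ℤ), (0 : ℤ)) ∉ 𝒟.S := by rw [hS]; exact six_Ktypes.2.2.2.2.1.1
  have h23 : ((2 : ℤ), (3 : ℤ)) ∈ 𝒟.S := by rw [hS]; exact six_Ktypes.2.2.2.2.1.2.1
  have h2m3 : ((2 : ℤ), (-3 : ℤ)) ∉ 𝒟.S := by rw [hS]; exact six_Ktypes.2.2.2.2.1.2.2
  have h16 : ((1 : ℤ), (6 : ℤ)) ∉ 𝒟.S := by rw [hS]; exact six_Ktypes₂.2.2.2.2.1.1
  have h30 : ((3 : ℤ), (0 : ℤ)) ∉ 𝒟.S := by rw [hS]; exact six_Ktypes₂.2.2.2.2.1.2.1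
  have h1m6 : ((1 : ℤ), (-6 : ℤ)) ∉ 𝒟.S := by rw [hS]; exact six_Ktypes₂.2.2.2.2.1.2.2
  have h0 : 𝒟.relCochain 0 = ⊥ := 𝒟.relCochain_zero_eq_bot h10
  have h2 : 𝒟.relCochain 2 = ⊥ := 𝒟.relCochain_two_eq_bot h16 h30 h10 h1m6
  have h4 : 𝒟.relCochain 4 = ⊥ := 𝒟.relCochain_four_eq_bot h10
  rw [𝒟.finrank_relCohomology_eq_finrank_relCochain_of_even h0 h2 h4]
  rcases Nat.lt_or_ge q 5 with hq | hq
  · interval_cases q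
    · rw [h0, finrank_bot, if_neg (by omega)]
    · rw [finrank_relCochain_one, if_pos h23, if_neg h2m3, if_pos (Or.inl rfl)]
    · rw [h2, finrank_bot, if_neg (by omega)]
    · rw [finrank_relCochain_three, if_pos h23, if_neg h2m3, if_pos (Or.inr rfl)]
    · rw [h4, finrank_bot, if_neg (by omega)]
  · rw [𝒟.relCochain_eq_bot_of_five_le hq, finrank_bot, if_neg (by omega)]

/-- A datum with the `K`-types of `J_{0,1} = Z(-3)` has `dim H^q = [q ∈ {1,3}]`. [cite: BorelWallach2000, VI Thm 4.11 (3)] -/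
theorem finrank_relCohomology_of_S_eq_ladderMinus (hS : 𝒟.S = ladderMinus.S) (q : ℕ) :
    finrank ℂ (relCohomology ℂ gl3 𝒟.V kSub q) = if q = 1 ∨ q = 3 then 1 else 0 := by
  have h10 : ((1 : ℤ), (0 : ℤ)) ∉ 𝒟.S := by rw [hS]; exact six_Ktypes.2.2.2.2.2.1
  have h23 : ((2 : ℤ), (3 : ℤ)) ∉ 𝒟.S := by rw [hS]; exact six_Ktypes.2.2.2.2.2.2.1
  have h2m3 : ((2 : ℤ), (-3 : ℤ)) ∈ 𝒟.S := by rw [hS]; exact six_Ktypes.2.2.2.2.2.2.2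
  have h16 : ((1 : ℤ), (6 : ℤ)) ∉ 𝒟.S := by rw [hS]; exact six_Ktypes₂.2.2.2.2.2.1
  have h30 : ((3 : ℤ), (0 : ℤ)) ∉ 𝒟.S := by rw [hS]; exact six_Ktypes₂.2.2.2.2.2.2.1
  have h1m6 : ((1 : ℤ), (-6 : ℤ)) ∉ 𝒟.S := by rw [hS]; exact six_Ktypes₂.2.2.2.2.2.2.2
  have h0 : 𝒟.relCochain 0 = ⊥ := 𝒟.relCochain_zero_eq_bot h10
  have h2 : 𝒟.relCochain 2 = ⊥ := 𝒟.relCochain_two_eq_bot h16 h30 h10 h1m6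
  have h4 : 𝒟.relCochain 4 = ⊥ := 𝒟.relCochain_four_eq_bot h10
  rw [𝒟.finrank_relCohomology_eq_finrank_relCochain_of_even h0 h2 h4]
  rcases Nat.lt_or_ge q 5 with hq | hq
  · interval_cases q
    · rw [h0, finrank_bot, if_neg (by omega)]
    · rw [finrank_relCochain_one, if_neg h23, if_pos h2m3, if_pos (Or.inl rfl)]
    · rw [h2, finrank_bot, if_neg (by omega)]
    · rw [finrank_relCochain_three, if_neg h23, if_pos h2m3, if_pos (Or.inr rfl)]
    · rw [h4, finrank_bot, if_neg (by omega)]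
  · rw [𝒟.relCochain_eq_bot_of_five_le hq, finrank_bot, if_neg (by omega)]

/-! ## §3 Borel–Wallach VI Thm 4.11 for an arbitrary irreducible datum -/

/-- **Borel–Wallach VI Thm 4.11 for `SU(2,1)`, datum form (the table).** An irreducible datum with
`dim H^{q₀}(𝔤𝔩₃, 𝔨; V) ≠ 0` for some `q₀` has the `K`-types of one of the six modules and the corresponding
cohomology in ALL degrees: `J_{0,0}`: `ℂ` in degrees `0, 2, 4`; `D₂, D₀, D₁`: `ℂ` in degree `2`;
`J_{1,0}, J_{0,1}`: `ℂ` in degrees `1, 3`; zero otherwise.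
[cite: BorelWallach2000, VI 4.8 p. 131, Thm 4.11 (1)–(3) p. 132] -/
theorem table_of_isIrreducible [LieModule.IsIrreducible ℂ gl3 𝒟.V] {q₀ : ℕ}
    (hq₀ : finrank ℂ (relCohomology ℂ gl3 𝒟.V kSub q₀) ≠ 0) :
    (𝒟.S = trivialMod.S ∧
        ∀ q, finrank ℂ (relCohomology ℂ gl3 𝒟.V kSub q) = if q = 0 ∨ q = 2 ∨ q = 4 then 1 else 0) ∨
    (𝒟.S = holDS.S ∧ ∀ q, finrank ℂ (relCohomology ℂ gl3 𝒟.V kSub q) = if q = 2 then 1 else 0) ∨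
    (𝒟.S = antiholDS.S ∧ ∀ q, finrank ℂ (relCohomology ℂ gl3 𝒟.V kSub q) = if q = 2 then 1 else 0) ∨
    (𝒟.S = ladderPlus.S ∧
        ∀ q, finrank ℂ (relCohomology ℂ gl3 𝒟.V kSub q) = if q = 1 ∨ q = 3 then 1 else 0) ∨
    (𝒟.S = ladderMinus.S ∧
        ∀ q, finrank ℂ (relCohomology ℂ gl3 𝒟.V kSub q) = if q = 1 ∨ q = 3 then 1 else 0) ∨
    (𝒟.S = midDS.S ∧ ∀ q, finrank ℂ (relCohomology ℂ gl3 𝒟.V kSub q) = if q = 2 then 1 else 0) := by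
  rcases 𝒟.S_eq_six_of_isIrreducible hq₀ with h | h | h | h | h | h
  · exact Or.inl ⟨h, 𝒟.finrank_relCohomology_of_S_eq_trivialMod h⟩
  · exact Or.inr (Or.inl ⟨h, 𝒟.finrank_relCohomology_of_S_eq_holDS h⟩)
  · exact Or.inr (Or.inr (Or.inl ⟨h, 𝒟.finrank_relCohomology_of_S_eq_antiholDS h⟩))
  · exact Or.inr (Or.inr (Or.inr (Or.inl ⟨h, 𝒟.finrank_relCohomology_of_S_eq_ladderPlus h⟩)))
  · exact Or.inr (Or.inr (Or.inr (Or.inr (Or.inl ⟨h, 𝒟.finrank_relCohomology_of_S_eq_ladderMinus h⟩))))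
  · exact Or.inr (Or.inr (Or.inr (Or.inr (Or.inr ⟨h, 𝒟.finrank_relCohomology_of_S_eq_midDS h⟩))))

/-- **An irreducible cohomological datum has the cohomology of its model**: there is `T` among the six
modules with `𝒟.S = T.S` and `dim H^q(𝔤𝔩₃, 𝔨; 𝒟.V) = dim H^q(𝔤𝔩₃, 𝔨; T.V)` for all `q`.
[cite: BorelWallach2000, VI Thm 4.11 p. 132] -/
theorem exists_model_cohomology_of_isIrreducible [LieModule.IsIrreducible ℂ gl3 𝒟.V] {q₀ : ℕ}
    (hq₀ : finrank ℂ (relCohomology ℂ gl3 𝒟.V kSub q₀) ≠ 0) :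
    ∃ T : SU21Datum, (T = trivialMod ∨ T = holDS ∨ T = antiholDS ∨ T = ladderPlus ∨
        T = ladderMinus ∨ T = midDS) ∧ 𝒟.S = T.S ∧
      ∀ q, finrank ℂ (relCohomology ℂ gl3 𝒟.V kSub q) = finrank ℂ (relCohomology ℂ gl3 T.V kSub q) := by
  rcases 𝒟.table_of_isIrreducible hq₀ with ⟨h, ht⟩ | ⟨h, ht⟩ | ⟨h, ht⟩ | ⟨h, ht⟩ | ⟨h, ht⟩ | ⟨h, ht⟩
  · exact ⟨trivialMod, Or.inl rfl, h, fun q => by rw [ht, finrank_relCohomology_trivialMod]⟩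
  · exact ⟨holDS, Or.inr (Or.inl rfl), h, fun q => by rw [ht, finrank_relCohomology_holDS]⟩
  · exact ⟨antiholDS, Or.inr (Or.inr (Or.inl rfl)), h, fun q => by rw [ht, finrank_relCohomology_antiholDS]⟩
  · exact ⟨ladderPlus, Or.inr (Or.inr (Or.inr (Or.inl rfl))), h, fun q => by
      rw [ht, finrank_relCohomology_ladderPlus]⟩
  · exact ⟨ladderMinus, Or.inr (Or.inr (Or.inr (Or.inr (Or.inl rfl)))), h, fun q => by
      rw [ht, finrank_relCohomology_ladderMinus]⟩
  · exact ⟨midDS, Or.inr (Or.inr (Or.inr (Or.inr (Or.inr rfl)))), h, fun q => by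
      rw [ht, finrank_relCohomology_midDS]⟩

/-- **`Π^ρ(SU(2,1))` at the level of `K`-type data.** For an irreducible datum, SOME `H^q(𝔤𝔩₃, 𝔨; V)` is
non-zero iff the `K`-types are those of one of the six modules `U(0)`, `U(0,±6)`, `Z(±3)`, `W(3,0)` (the
converse direction holds for every datum with these `K`-types, by §2).
[cite: BorelWallach2000, VI 4.8 p. 131 (definition of `Π^ρ(G)`), Thm 4.11 p. 132] -/
theorem exists_finrank_relCohomology_ne_zero_iff_of_isIrreducible [LieModule.IsIrreducible ℂ gl3 𝒟.V] :
    (∃ q, finrank ℂ (relCohomology ℂ gl3 𝒟.V kSub q) ≠ 0) ↔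
      (𝒟.S = trivialMod.S ∨ 𝒟.S = holDS.S ∨ 𝒟.S = antiholDS.S ∨ 𝒟.S = ladderPlus.S ∨
        𝒟.S = ladderMinus.S ∨ 𝒟.S = midDS.S) := by
  constructor
  · rintro ⟨q, hq⟩
    exact 𝒟.S_eq_six_of_isIrreducible hq
  · rintro (h | h | h | h | h | h)
    · exact ⟨0, by rw [𝒟.finrank_relCohomology_of_S_eq_trivialMod h, if_pos (Or.inl rfl)]; exact one_ne_zero⟩
    · exact ⟨2, by rw [𝒟.finrank_relCohomology_of_S_eq_holDS h, if_pos rfl]; exact one_ne_zero⟩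
    · exact ⟨2, by rw [𝒟.finrank_relCohomology_of_S_eq_antiholDS h, if_pos rfl]; exact one_ne_zero⟩
    · exact ⟨1, by rw [𝒟.finrank_relCohomology_of_S_eq_ladderPlus h, if_pos (Or.inl rfl)]; exact one_ne_zero⟩
    · exact ⟨1, by rw [𝒟.finrank_relCohomology_of_S_eq_ladderMinus h, if_pos (Or.inl rfl)]; exact one_ne_zero⟩
    · exact ⟨2, by rw [𝒟.finrank_relCohomology_of_S_eq_midDS h, if_pos rfl]; exact one_ne_zero⟩

/-- **Multiplicity one.** For every irreducible datum and every `q`, `dim H^q(𝔤𝔩₃, 𝔨; V) ≤ 1`.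
[cite: BorelWallach2000, VI Thm 4.11 (2), (3)] -/
theorem finrank_relCohomology_le_one_of_isIrreducible [LieModule.IsIrreducible ℂ gl3 𝒟.V] (q : ℕ) :
    finrank ℂ (relCohomology ℂ gl3 𝒟.V kSub q) ≤ 1 := by
  by_cases hq : finrank ℂ (relCohomology ℂ gl3 𝒟.V kSub q) = 0
  · rw [hq]; exact zero_le_one
  rcases 𝒟.table_of_isIrreducible hq with ⟨-, ht⟩ | ⟨-, ht⟩ | ⟨-, ht⟩ | ⟨-, ht⟩ | ⟨-, ht⟩ | ⟨-, ht⟩ <;>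
    (rw [ht]; split_ifs <;> simp)

/-- **`H¹` detects the ladder representations.** An irreducible datum has `H¹(𝔤𝔩₃, 𝔨; V) ≠ 0` iff its
`K`-types are those of `J_{1,0} = Z(3)` or of `J_{0,1} = Z(-3)`; then `dim H¹ = 1`.
[cite: BorelWallach2000, VI Thm 4.11 (3) (`i + j = 1`)] -/
theorem finrank_relCohomology_one_ne_zero_iff_of_isIrreducible [LieModule.IsIrreducible ℂ gl3 𝒟.V] :
    finrank ℂ (relCohomology ℂ gl3 𝒟.V kSub 1) ≠ 0 ↔ 𝒟.S = ladderPlus.S ∨ 𝒟.S = ladderMinus.S := by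
  constructor
  · intro h1
    rcases 𝒟.table_of_isIrreducible h1 with ⟨-, ht⟩ | ⟨-, ht⟩ | ⟨-, ht⟩ | ⟨h, -⟩ | ⟨h, -⟩ | ⟨-, ht⟩
    · exact absurd (by rw [ht, if_neg (by omega)]) h1
    · exact absurd (by rw [ht, if_neg (by omega)]) h1
    · exact absurd (by rw [ht, if_neg (by omega)]) h1
    · exact Or.inl h
    · exact Or.inr h
    · exact absurd (by rw [ht, if_neg (by omega)]) h1
  · rintro (h | h)
    · rw [𝒟.finrank_relCohomology_of_S_eq_ladderPlus h, if_pos (Or.inl rfl)]; exact one_ne_zero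
    · rw [𝒟.finrank_relCohomology_of_S_eq_ladderMinus h, if_pos (Or.inl rfl)]; exact one_ne_zero

/-- **`H²` detects `J_{0,0}` and the discrete series.** An irreducible datum has `H²(𝔤𝔩₃, 𝔨; V) ≠ 0` iff its
`K`-types are those of `U(0)`, `D₂`, `D₀` or `D₁`; then `dim H² = 1`.
[cite: BorelWallach2000, VI Thm 4.11 (2), (3)] -/
theorem finrank_relCohomology_two_ne_zero_iff_of_isIrreducible [LieModule.IsIrreducible ℂ gl3 𝒟.V] :
    finrank ℂ (relCohomology ℂ gl3 𝒟.V kSub 2) ≠ 0 ↔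
      𝒟.S = trivialMod.S ∨ 𝒟.S = holDS.S ∨ 𝒟.S = antiholDS.S ∨ 𝒟.S = midDS.S := by
  constructor
  · intro h2
    rcases 𝒟.table_of_isIrreducible h2 with ⟨h, -⟩ | ⟨h, -⟩ | ⟨h, -⟩ | ⟨-, ht⟩ | ⟨-, ht⟩ | ⟨h, -⟩
    · exact Or.inl h
    · exact Or.inr (Or.inl h)
    · exact Or.inr (Or.inr (Or.inl h))
    · exact absurd (by rw [ht, if_neg (by omega)]) h2
    · exact absurd (by rw [ht, if_neg (by omega)]) h2
    · exact Or.inr (Or.inr (Or.inr h))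
  · rintro (h | h | h | h)
    · rw [𝒟.finrank_relCohomology_of_S_eq_trivialMod h, if_pos (Or.inr (Or.inl rfl))]; exact one_ne_zero
    · rw [𝒟.finrank_relCohomology_of_S_eq_holDS h, if_pos rfl]; exact one_ne_zero
    · rw [𝒟.finrank_relCohomology_of_S_eq_antiholDS h, if_pos rfl]; exact one_ne_zero
    · rw [𝒟.finrank_relCohomology_of_S_eq_midDS h, if_pos rfl]; exact one_ne_zero

/-- **Poincaré-duality shape.** For an irreducible datum, `dim H^q = dim H^{4-q}` for `q ≤ 4`
(`4 = dim_ℝ SU(2,1)/K`). [cite: BorelWallach2000, I §1.6, VI Thm 4.11 (2), (3)] -/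
theorem finrank_relCohomology_eq_four_sub_of_isIrreducible [LieModule.IsIrreducible ℂ gl3 𝒟.V] {q : ℕ}
    (hq : q ≤ 4) :
    finrank ℂ (relCohomology ℂ gl3 𝒟.V kSub q) = finrank ℂ (relCohomology ℂ gl3 𝒟.V kSub (4 - q)) := by
  by_cases h0 : ∀ p, finrank ℂ (relCohomology ℂ gl3 𝒟.V kSub p) = 0
  · rw [h0, h0]
  push Not at h0
  obtain ⟨p, hp⟩ := h0
  rcases 𝒟.table_of_isIrreducible hp with ⟨-, ht⟩ | ⟨-, ht⟩ | ⟨-, ht⟩ | ⟨-, ht⟩ | ⟨-, ht⟩ | ⟨-, ht⟩ <;>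
    (rw [ht, ht]; interval_cases q <;> simp)

end SU21Datum

end Literature.RepresentationTheory.Kovacevic2021
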